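import Literature.AnabelianGeometry.SemiGraphs.PSCSmoothCurveGenuineInputs
import Literature.AnabelianGeometry.SemiGraphs.PSCSmoothCurveCuspidalCharacterization
import HarnessLib

/-!
# [IUTchI] Rmk. 1.2.3 (iv) (cuspidal) and [CombGC] Thm. 1.6 (i) at the pro-`ℓ` GENUINE smooth-curve origin

Mochizuki, *A combinatorial version of the Grothendieck conjecture* [CombGC], Tohoku Math. J. **59**
(2007), Thm. 1.6 (i) p. 13 ("`α` is numerically cuspidal if and only if it is group-theoretically
cuspidal"); [IUTchI] Rmk. 1.2.3 (iv) pp. 41–42 (the characterization of cuspidal edge-like subgroups);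
Def. 1.1 (ii) p. 6 ("determines, up to conjugation, a closed subgroup").
[cite: MochizukiCombGC2007, Thm 1.6(i) p.13] [cite: Mochizuki2012, IUTchI Rmk 1.2.3(iv) pp.41-42]

PROOF-ONLY file (abc-iut cell, layer L3, [CombGC] non-vacuity programme; seat abc-iut-w5-d195 gen 7,
brick «SC-GENUINE-COVERING-CLOSED», part H; sequel of `PSCSmoothCurveGenuineInputs.lean` and of
abc-iut-f-164's `PSCSmoothCurveCuspidalCharacterization.lean`).  abc-iut-f-164 / -L3-t4 proved F-1931
(`CuspidalEdgeLikeCharacterization`) and F-0458 (Thm. 1.6 (i), `NumericallyCuspidalIffHolds`) at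
smooth-curve data whose cusp groups are EXACTLY the closed cusp inertia groups.  Both predicates see the
cusp groups only through their CONJUGACY CLASSES (`IsCuspidal`, `IsCuspidallyTotallyRamified`), so they
transfer to data with ARBITRARY representatives `δ_c closure(ι⟨c_{e c}⟩) δ_c⁻¹` — the data of the
covering-closed genuine smooth-curve origin — through the auxiliary datum with the rigid representatives:

* `isCuspidal_iff_of_cuspGp_eq_smul`, `isCuspidallyTotallyRamified_iff_of_cuspGp_eq_smul`,
  `cuspidalEdgeLikeCharacterization_iff_of_cuspGp_eq_smul` — representative-independence;
* `cuspidalEdgeLikeCharacterization_of_smoothCurve'` (F-1931, relaxed clause),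
  `cuspidalEdgeLikeCharacterizationHolds_of_smoothCurve'`, `numericallyCuspidalIffHolds_of_smoothCurve'`
  (F-0458 at pro-`ℓ` origins, via abc-iut-f-164's reduction `numericallyCuspidalIffHolds_of_characterization`
  and Prop. 1.2 (i) `openInterDeterminesComponentHolds_of_smoothCurve'`);
* `exists_smoothCurveGenuineProLOrigin_holds` — for EVERY prime `ℓ`, the pro-`ℓ` genuine smooth-curve
  origin `Ω_scg^{(ℓ)}` (fixed `Σ = {ℓ}`) is inhabited by every hyperbolic `(g, r)` and carries, jointly:
  `RestrictBDOfPSCTypeHolds`, `SturdyCoverHolds`, `UnrVertAbOfRankHolds`, `UnrVerticialCharacterizationHolds'`,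
  `VertCountLeNodeCountSuccHolds`, `VertexSetCharacterizationHolds`, F-2830, F-0438, F-0459, F-0440, F-0461,
  F-0443, **F-1931** and **F-0458 (Thm. 1.6 (i))**.

Consistency / non-vacuity evidence at genuine one-component data WITH cusps and all their finite étale
coverings; not the printed theorems for all pointed stable curves; 0 definitions; nothing here takes a
side on [IUTchIII] Cor. 3.12.
-/

noncomputable section

namespace Literature.AnabelianGeometry.SemiGraphs

namespace PSCDatum

open scoped Pointwise
open Literature.GroupTheory.CombinatorialGroupTheory
open Literature.GroupTheory.CombinatorialGroupTheory.PuncturedSurfaceGroup (cuspInertia IsHyperbolicType)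
open SemiGraphOfAnabelioids (IsProSigmaCompletion)
open SemiGraphOfAnabelioids.IsProSigmaCompletion (exists_isProSigmaCompletion)

universe u

variable {P : Type u} [Group P] [TopologicalSpace P]

/-! ### Representative-independence of the cuspidal predicates -/

section Representatives

variable (G G₀ : PSCDatum P) (hg : G₀.graph = G.graph)

omit [TopologicalSpace P] in
/-- Conjugacy classes of subgroups do not see the representative: `(∃ γ, A = γ • (δ • X)) ↔ ∃ γ, A = γ • X`.
[cite: MochizukiCombGC2007, Def 1.1(ii) p.6] -/
theorem exists_eq_smul_smul_iff (A X : Subgroup P) (δ : ConjAct P) :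
    (∃ γ : ConjAct P, A = γ • (δ • X)) ↔ ∃ γ : ConjAct P, A = γ • X := by
  constructor
  · rintro ⟨γ, rfl⟩
    exact ⟨γ * δ, (mul_smul _ _ _).symm⟩
  · rintro ⟨γ, rfl⟩
    exact ⟨γ * δ⁻¹, by rw [mul_smul, inv_smul_smul]⟩

end Representatives

section Transfer

variable {G G₀ : PSCDatum P}

/-- If `G` and `G₀` have the same underlying semi-graph, `Σ`, vertex and node data and `G`'s cusp groups
are conjugates of `G₀`'s, then they have the same cuspidal subgroups.  (Stated for `G₀ := {G with cuspGp
:= …}`, so that all other fields agree definitionally.) [cite: MochizukiCombGC2007, Def 1.1(ii) p.7] -/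
theorem isCuspidal_iff_of_cuspGp_eq_smul (cusp₀ : G.graph.C → Subgroup P)
    (hc₀ : ∀ c, IsClosed (cusp₀ c : Set P))
    (hle₀ : ∀ c, ∃ γ : ConjAct P, γ • cusp₀ c ≤ G.vertGp (G.graph.cuspEnd c))
    (hδ : ∀ c, ∃ δ : ConjAct P, G.cuspGp c = δ • cusp₀ c) (A : Subgroup P) :
    G.IsCuspidal A ↔ ({ G with cuspGp := cusp₀, isClosed_cuspGp := hc₀, cuspGp_le := hle₀ } : PSCDatum P).IsCuspidal A := by
  constructor
  · rintro ⟨c, γ, rfl⟩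
    obtain ⟨δ, hδc⟩ := hδ c
    exact ⟨c, γ * δ, by rw [hδc, mul_smul]⟩
  · rintro ⟨c, γ, rfl⟩
    obtain ⟨δ, hδc⟩ := hδ c
    refine ⟨c, γ * δ⁻¹, ?_⟩
    change γ • cusp₀ c = _
    rw [hδc, mul_smul, inv_smul_smul]

/-- Likewise for "cuspidally totally ramified" (Def. 1.4 (v)). [cite: MochizukiCombGC2007, Def 1.4(v) p.11] -/
theorem isCuspidallyTotallyRamified_iff_of_cuspGp_eq_smul (cusp₀ : G.graph.C → Subgroup P)
    (hc₀ : ∀ c, IsClosed (cusp₀ c : Set P))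
    (hle₀ : ∀ c, ∃ γ : ConjAct P, γ • cusp₀ c ≤ G.vertGp (G.graph.cuspEnd c))
    (hδ : ∀ c, ∃ δ : ConjAct P, G.cuspGp c = δ • cusp₀ c) (H'' H' : Subgroup P) :
    G.IsCuspidallyTotallyRamified H'' H' ↔
      ({ G with cuspGp := cusp₀, isClosed_cuspGp := hc₀, cuspGp_le := hle₀ } : PSCDatum P).IsCuspidallyTotallyRamified
        H'' H' := by
  unfold IsCuspidallyTotallyRamified
  refine and_congr Iff.rfl ⟨?_, ?_⟩
  · rintro ⟨c, γ, h⟩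
    obtain ⟨δ, hδc⟩ := hδ c
    exact ⟨c, γ * δ, by rw [mul_smul]; rw [hδc] at h; exact h⟩
  · rintro ⟨c, γ, h⟩
    obtain ⟨δ, hδc⟩ := hδ c
    refine ⟨c, γ * δ⁻¹, ?_⟩
    rw [hδc, mul_smul, inv_smul_smul]
    exact h

variable [IsTopologicalGroup P] in
/-- Hence the [IUTchI] Rmk. 1.2.3 (iv) characterization of cuspidal subgroups (F-1931) is
representative-independent. [cite: Mochizuki2012, IUTchI Rmk 1.2.3(iv) pp.41-42] -/
theorem cuspidalEdgeLikeCharacterization_iff_of_cuspGp_eq_smul (cusp₀ : G.graph.C → Subgroup P)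
    (hc₀ : ∀ c, IsClosed (cusp₀ c : Set P))
    (hle₀ : ∀ c, ∃ γ : ConjAct P, γ • cusp₀ c ≤ G.vertGp (G.graph.cuspEnd c))
    (hδ : ∀ c, ∃ δ : ConjAct P, G.cuspGp c = δ • cusp₀ c) :
    G.CuspidalEdgeLikeCharacterization ↔
      ({ G with cuspGp := cusp₀, isClosed_cuspGp := hc₀, cuspGp_le := hle₀ } : PSCDatum P).CuspidalEdgeLikeCharacterization := by
  have h1 : G.IsCuspidal =
      ({ G with cuspGp := cusp₀, isClosed_cuspGp := hc₀, cuspGp_le := hle₀ } : PSCDatum P).IsCuspidal :=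
    funext fun A => propext (isCuspidal_iff_of_cuspGp_eq_smul cusp₀ hc₀ hle₀ hδ A)
  have h2 : G.IsCuspidallyTotallyRamified =
      ({ G with cuspGp := cusp₀, isClosed_cuspGp := hc₀, cuspGp_le := hle₀ } : PSCDatum P).IsCuspidallyTotallyRamified :=
    funext fun X => funext fun Y => propext (isCuspidallyTotallyRamified_iff_of_cuspGp_eq_smul cusp₀ hc₀ hle₀ hδ X Y)
  unfold CuspidalEdgeLikeCharacterization
  rw [h1, h2]

end Transfer

/-! ### F-1931 and F-0458 at smooth-curve data with arbitrary cusp representatives -/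

section SmoothCurve

variable [IsTopologicalGroup P] [CompactSpace P] [T2Space P] [TotallyDisconnectedSpace P]
variable {Sigma : Set ℕ} {g r : ℕ}

/-- **F-1931 (`CuspidalEdgeLikeCharacterization`) HOLDS at smooth-curve data with arbitrary cusp
representatives** (abc-iut-f-164's theorem at the auxiliary datum with the rigid representatives,
transferred). [cite: Mochizuki2012, IUTchI Rmk 1.2.3(iv) pp.41-42] -/
theorem cuspidalEdgeLikeCharacterization_of_smoothCurve' (hne : Sigma.Nonempty)
    (hprime : ∀ p ∈ Sigma, p.Prime) (h : IsHyperbolicType g r) (ι : PuncturedSurfaceGroup g r →* P)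
    (hι : IsProSigmaCompletion Sigma ι) (G : PSCDatum P) (e : G.graph.C ≃ Fin r)
    (hC : ∀ c, ∃ δ : ConjAct P,
      G.cuspGp c = δ • ((cuspInertia (g := g) (e c)).map ι).topologicalClosure) :
    G.CuspidalEdgeLikeCharacterization := by
  have hle₀ : ∀ c, ∃ γ : ConjAct P,
      γ • ((cuspInertia (g := g) (e c)).map ι).topologicalClosure ≤ G.vertGp (G.graph.cuspEnd c) := by
    intro c
    obtain ⟨γ, hγ⟩ := G.cuspGp_le c
    obtain ⟨δ, hδ⟩ := hC c
    exact ⟨γ * δ, by rw [mul_smul, ← hδ]; exact hγ⟩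
  rw [cuspidalEdgeLikeCharacterization_iff_of_cuspGp_eq_smul
    (fun c => ((cuspInertia (g := g) (e c)).map ι).topologicalClosure)
    (fun _ => Subgroup.isClosed_topologicalClosure _) hle₀ hC]
  exact cuspidalEdgeLikeCharacterization_of_smoothCurve hne hprime h ι hι _ e fun _ => rfl

end SmoothCurve

/-! ### Origin level -/

section Origin

variable (Ω : PSCOrigin.{u}) (l : ℕ)

/-- **F-1931 at every origin of smooth-curve data with arbitrary cusp representatives.**
[cite: Mochizuki2012, IUTchI Rmk 1.2.3(iv) pp.41-42] -/
theorem cuspidalEdgeLikeCharacterizationHolds_of_smoothCurve'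
    (hΩ : ∀ ⦃Q : Type u⦄ [Group Q] [TopologicalSpace Q] [IsTopologicalGroup Q] (G : PSCDatum Q),
      Ω.IsOfPSCType G → CompactSpace Q ∧ T2Space Q ∧ TotallyDisconnectedSpace Q ∧ IsEmpty G.graph.N ∧
        (∃ v₀ : G.graph.V, ∀ w, w = v₀) ∧
        ∃ (S : Set ℕ) (g r : ℕ) (ι : PuncturedSurfaceGroup g r →* Q) (e : G.graph.C ≃ Fin r),
          S.Nonempty ∧ (∀ p ∈ S, p.Prime) ∧ IsHyperbolicType g r ∧ IsProSigmaCompletion S ι ∧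
          ∀ c, ∃ δ : ConjAct Q, G.cuspGp c =
            δ • ((cuspInertia (g := g) (e c)).map ι).topologicalClosure) :
    CuspidalEdgeLikeCharacterizationHolds Ω := by
  intro Q _ _ _ G hG
  obtain ⟨hc, ht, hd, -, -, S, g, r, ι, e, hne, hprime, hh, hι, hC⟩ := hΩ G hG
  exact cuspidalEdgeLikeCharacterization_of_smoothCurve' hne hprime hh ι hι G e hC

/-- **[CombGC] Thm. 1.6 (i) as printed (F-0458) HOLDS at every pro-`l` origin of smooth-curve data with
arbitrary cusp representatives**: abc-iut-f-164's reduction to F-1931 + Prop. 1.2 (i), both theorems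
there. [cite: MochizukiCombGC2007, Thm 1.6(i) p.13] -/
theorem numericallyCuspidalIffHolds_of_smoothCurve'
    (hΩ : ∀ ⦃Q : Type u⦄ [Group Q] [TopologicalSpace Q] [IsTopologicalGroup Q] (G : PSCDatum Q),
      Ω.IsOfPSCType G → CompactSpace Q ∧ T2Space Q ∧ TotallyDisconnectedSpace Q ∧ IsEmpty G.graph.N ∧
        (∃ v₀ : G.graph.V, ∀ w, w = v₀) ∧
        ∃ (S : Set ℕ) (g r : ℕ) (ι : PuncturedSurfaceGroup g r →* Q) (e : G.graph.C ≃ Fin r),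
          S.Nonempty ∧ (∀ p ∈ S, p.Prime) ∧ IsHyperbolicType g r ∧ IsProSigmaCompletion S ι ∧
          ∀ c, ∃ δ : ConjAct Q, G.cuspGp c =
            δ • ((cuspInertia (g := g) (e c)).map ι).topologicalClosure)
    (hSig : ∀ ⦃Q : Type u⦄ [Group Q] [TopologicalSpace Q] [IsTopologicalGroup Q] (G : PSCDatum Q),
      Ω.IsOfPSCType G → G.Sigma = {l}) :
    NumericallyCuspidalIffHolds Ω :=
  numericallyCuspidalIffHolds_of_characterization Ω l
    (fun _ _ _ _ G hG => ⟨(hΩ G hG).1, (hΩ G hG).2.2.1⟩) hSig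
    (openInterDeterminesComponentHolds_of_smoothCurve' Ω hΩ)
    (cuspidalEdgeLikeCharacterizationHolds_of_smoothCurve' Ω hΩ)

end Origin

/-! ### The pro-`ℓ` genuine smooth-curve origin, fixed `ℓ`: everything together, with Thm. 1.6 (i) -/

/-- **For every prime `ℓ`, the pro-`ℓ` GENUINE smooth-curve origin carries the [CombGC] §1 / [IUTchI]
Rmk. 1.2.3 family INCLUDING Thm. 1.6 (i).**  Let `Ω` declare "of PSC-type" exactly the data over a
PROFINITE group with no nodes, one vertex with `Π_v = Π`, `Σ = {ℓ}`, a pro-`ℓ` completion `ι : Γ_{g,r} → Π`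
of a hyperbolic punctured surface group with `genus(v) = g`, a bijection `e : cusps ≃ Fin r`, and cusp
groups conjugates `δ_c closure(ι⟨c_{e c}⟩) δ_c⁻¹`.  Then `Ω` contains the pro-`ℓ` smooth curve of every
hyperbolic type `(g, r)`; `RestrictBDOfPSCTypeHolds Ω`; every `Ω`-datum is profinite; and `SturdyCoverHolds`,
`UnrVertAbOfRankHolds`, `UnrVerticialCharacterizationHolds'`, `VertCountLeNodeCountSuccHolds`,
`VertexSetCharacterizationHolds`, `SeparatingCoveringsHolds` (F-2830), `CommensurableTerminalityHolds`
(F-0438), `OpenInterDeterminesComponentHolds` (F-0459), `EdgeLikeIncidenceHolds` (F-0440),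
`UnrVerticialIffHolds` (F-0461), `GraphicIffEdgeLikeVerticialHolds` (F-0443),
`CuspidalEdgeLikeCharacterizationHolds` (F-1931) and `NumericallyCuspidalIffHolds` (F-0458, Thm. 1.6 (i))
all hold at `Ω`.  Non-vacuity evidence at genuine data with cusps and all their finite étale coverings; not
the printed theorems for all pointed stable curves. [cite: MochizukiCombGC2007, Thm 1.6(i) p.13] -/
theorem exists_smoothCurveGenuineProLOrigin_holds (ℓ : ℕ) (hℓ : ℓ.Prime) :
    ∃ Ω : PSCOrigin.{0},
      (∀ (g r : ℕ), IsHyperbolicType g r →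
        ∃ (Q : ProfiniteGrp.{0}) (ι : PuncturedSurfaceGroup g r →* Q) (G : PSCDatum Q),
          IsProSigmaCompletion {ℓ} ι ∧ Ω.IsOfPSCType G ∧ G.Sigma = {ℓ} ∧ G.graph.i = 1 ∧ G.graph.n = 0 ∧
            G.graph.r = r ∧ (∀ v, G.vertGp v = ⊤ ∧ G.genus v = g) ∧
            ∃ e : G.graph.C ≃ Fin r, ∀ c, G.cuspGp c =
              ((cuspInertia (g := g) (e c)).map ι).topologicalClosure) ∧
      RestrictBDOfPSCTypeHolds Ω ∧
      (∀ ⦃Q : Type⦄ [Group Q] [TopologicalSpace Q] [IsTopologicalGroup Q] (G : PSCDatum Q),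
        Ω.IsOfPSCType G → CompactSpace Q ∧ T2Space Q ∧ TotallyDisconnectedSpace Q ∧ IsEmpty G.graph.N ∧
          (∀ v, G.vertGp v = ⊤) ∧ (∃ v₀ : G.graph.V, ∀ w, w = v₀) ∧ G.Sigma = {ℓ}) ∧
      SturdyCoverHolds Ω ∧ UnrVertAbOfRankHolds Ω ∧ UnrVerticialCharacterizationHolds' Ω ∧
      VertCountLeNodeCountSuccHolds Ω ∧ VertexSetCharacterizationHolds Ω ∧
      SeparatingCoveringsHolds Ω ∧ CommensurableTerminalityHolds Ω ∧ OpenInterDeterminesComponentHolds Ω ∧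
      EdgeLikeIncidenceHolds Ω ∧ UnrVerticialIffHolds Ω ∧ GraphicIffEdgeLikeVerticialHolds Ω ∧
      CuspidalEdgeLikeCharacterizationHolds Ω ∧ NumericallyCuspidalIffHolds Ω := by
  let Ω : PSCOrigin.{0} :=
    ⟨fun {Q} _ _ G => ∃ (_ : IsTopologicalGroup Q), CompactSpace Q ∧ T2Space Q ∧
      TotallyDisconnectedSpace Q ∧ IsEmpty G.graph.N ∧ (∀ v, G.vertGp v = ⊤) ∧
      (∃ v₀ : G.graph.V, ∀ w, w = v₀) ∧ G.Sigma = {ℓ} ∧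
      ∃ (g r : ℕ) (ι : PuncturedSurfaceGroup g r →* Q) (e : G.graph.C ≃ Fin r),
        IsHyperbolicType g r ∧ IsProSigmaCompletion G.Sigma ι ∧ (∀ v, G.genus v = g) ∧
        ∀ c, ∃ δ : ConjAct Q, G.cuspGp c = δ • ((cuspInertia (g := g) (e c)).map ι).topologicalClosure⟩
  have hΩ₁ : ∀ ⦃Q : Type⦄ [Group Q] [TopologicalSpace Q] [IsTopologicalGroup Q] (G : PSCDatum Q),
      Ω.IsOfPSCType G → CompactSpace Q ∧ T2Space Q ∧ TotallyDisconnectedSpace Q ∧ IsEmpty G.graph.N ∧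
        (∀ v, G.vertGp v = ⊤) ∧ (∃ v₀ : G.graph.V, ∀ w, w = v₀) ∧
        ∃ (S : Set ℕ) (g r : ℕ) (ι : PuncturedSurfaceGroup g r →* Q) (e : G.graph.C ≃ Fin r),
          S.Nonempty ∧ (∀ p ∈ S, p.Prime) ∧ IsHyperbolicType g r ∧ IsProSigmaCompletion S ι ∧
          ∀ c, ∃ δ : ConjAct Q, G.cuspGp c =
            δ • ((cuspInertia (g := g) (e c)).map ι).topologicalClosure := by
    intro Q _ _ _ G hG
    obtain ⟨_, hc, ht, hd, hN, hV, hv, -, g, r, ι, e, hgr, hι, -, hC⟩ := hG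
    exact ⟨hc, ht, hd, hN, hV, hv, G.Sigma, g, r, ι, e, G.sigma_nonempty, G.sigma_prime, hgr, hι, hC⟩
  have hΩ₁' : ∀ ⦃Q : Type⦄ [Group Q] [TopologicalSpace Q] [IsTopologicalGroup Q] (G : PSCDatum Q),
      Ω.IsOfPSCType G → CompactSpace Q ∧ T2Space Q ∧ TotallyDisconnectedSpace Q ∧ IsEmpty G.graph.N ∧
        (∃ v₀ : G.graph.V, ∀ w, w = v₀) ∧
        ∃ (S : Set ℕ) (g r : ℕ) (ι : PuncturedSurfaceGroup g r →* Q) (e : G.graph.C ≃ Fin r),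
          S.Nonempty ∧ (∀ p ∈ S, p.Prime) ∧ IsHyperbolicType g r ∧ IsProSigmaCompletion S ι ∧
          ∀ c, ∃ δ : ConjAct Q, G.cuspGp c =
            δ • ((cuspInertia (g := g) (e c)).map ι).topologicalClosure := fun Q _ _ _ G hG => by
    obtain ⟨h1, h2, h3, h4, -, h6, h7⟩ := hΩ₁ G hG
    exact ⟨h1, h2, h3, h4, h6, h7⟩
  have hΩ₂ : ∀ ⦃Q : Type⦄ [Group Q] [TopologicalSpace Q] (G : PSCDatum Q), Ω.IsOfPSCType G →
      IsEmpty G.graph.N ∧ (∀ v, G.vertGp v = ⊤) ∧ Nonempty G.graph.V := by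
    intro Q _ _ G hG
    obtain ⟨_, -, -, -, hN, hV, ⟨v₀, -⟩, -⟩ := hG
    exact ⟨hN, hV, ⟨v₀⟩⟩
  have hΩv : ∀ ⦃Q : Type⦄ [Group Q] [TopologicalSpace Q] (G : PSCDatum Q), Ω.IsOfPSCType G →
      (∀ v, G.vertGp v = ⊤) ∧ ∃ v₀ : G.graph.V, ∀ w, w = v₀ := by
    intro Q _ _ G hG
    obtain ⟨_, -, -, -, -, hV, hv, -⟩ := hG
    exact ⟨hV, hv⟩
  have hSig : ∀ ⦃Q : Type⦄ [Group Q] [TopologicalSpace Q] [IsTopologicalGroup Q] (G : PSCDatum Q),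
      Ω.IsOfPSCType G → G.Sigma = {ℓ} := by
    intro Q _ _ _ G hG
    obtain ⟨_, -, -, -, -, -, -, hS, -⟩ := hG
    exact hS
  have hprof : ∀ ⦃Q : Type⦄ [Group Q] [TopologicalSpace Q] [IsTopologicalGroup Q] (G : PSCDatum Q),
      Ω.IsOfPSCType G → CompactSpace Q ∧ T2Space Q ∧ TotallyDisconnectedSpace Q ∧ IsEmpty G.graph.N ∧
        (∀ v, G.vertGp v = ⊤) ∧ (∃ v₀ : G.graph.V, ∀ w, w = v₀) ∧ G.Sigma = {ℓ} := by
    intro Q _ _ _ H hH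
    obtain ⟨_, hc, ht, hd, hN, hV, hv, hS, -⟩ := hH
    exact ⟨hc, ht, hd, hN, hV, hv, hS⟩
  have hrank : UnrVertAbOfRankHolds Ω :=
    unrVertAbOfRankHolds_of_smoothCurveGenuine Ω fun Q _ _ _ G hG => by
      obtain ⟨_, -, ht, -, hN, hV, -, -, g, r, ι, e, -, hι, hgen, hC⟩ := hG
      exact ⟨ht, hN, hV, g, r, ι, e, hι, hgen, hC⟩
  have hunr : UnrVerticialCharacterizationHolds' Ω := unrVerticialCharacterizationHolds'_of_vertGp_eq_top Ω hΩv
  have hsturdy : SturdyCoverHolds Ω :=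
    sturdyCoverHolds_of_smoothCurveGenuine_singleton Ω fun Q _ _ _ G hG => by
      obtain ⟨_, hc, ht, hd, hN, hV, hv, hS, g, r, ι, e, hgr, hι, hgen, hC⟩ := hG
      exact ⟨hc, ht, hd, hN, hV, hv, ⟨ℓ, hℓ, hS⟩, g, r, ι, e, hgr, hι, hgen, hC⟩
  refine ⟨Ω, fun g r hgr => ?_, ?_, hprof, hsturdy, hrank, hunr,
    vertCountLeNodeCountSuccHolds_of_vertGp_eq_top Ω hΩv,
    vertexSetCharacterizationHolds_of_profiniteOrigin' Ω (fun Q _ _ G hG => ?_) hunr hrank, ?_,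
    commensurableTerminalityHolds_of_smoothCurve' Ω hΩ₁,
    openInterDeterminesComponentHolds_of_smoothCurve' Ω hΩ₁',
    edgeLikeIncidenceHolds_of_vertGp_eq_top Ω hΩ₂,
    unrVerticialIffHolds_of_vertGp_eq_top Ω (fun Q _ _ G hG => ⟨(hΩ₂ G hG).2.1, (hΩ₂ G hG).2.2⟩),
    graphicIffEdgeLikeVerticialHolds_of_smoothCurve' Ω hΩ₁ hΩ₂,
    cuspidalEdgeLikeCharacterizationHolds_of_smoothCurve' Ω hΩ₁',
    numericallyCuspidalIffHolds_of_smoothCurve' Ω ℓ hΩ₁' hSig⟩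
  · -- inhabitation: the pro-`ℓ` smooth curve of type `(g, r)`
    obtain ⟨Q, η, hη⟩ := exists_isProSigmaCompletion (PuncturedSurfaceGroup g r) ({ℓ} : Set ℕ)
    let T : PSCDatum Q :=
      { Sigma := {ℓ}
        sigma_prime := fun p hp => by rw [Set.mem_singleton_iff.mp hp]; exact hℓ
        sigma_nonempty := ⟨ℓ, Set.mem_singleton ℓ⟩
        graph := { V := Unit, N := Empty, C := Fin r, nodeEnds := Empty.elim, cuspEnd := fun _ => () }
        vertGp := fun _ => ⊤
        nodeGp := Empty.elim
        cuspGp := fun i => ((cuspInertia (g := g) i).map η).topologicalClosure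
        genus := fun _ => g
        isClosed_vertGp := fun _ => by rw [Subgroup.coe_top]; exact isClosed_univ
        isClosed_nodeGp := fun e => e.elim
        isClosed_cuspGp := fun _ => Subgroup.isClosed_topologicalClosure _
        nodeGp_le := fun e => e.elim
        cuspGp_le := fun _ => ⟨1, le_top⟩
        proSigma := isProSigma_of_isProSigmaCompletion hη }
    have hT : Ω.IsOfPSCType T :=
      ⟨inferInstance, inferInstance, inferInstance, inferInstance, inferInstanceAs (IsEmpty Empty),
        fun _ => rfl, ⟨(), fun _ => rfl⟩, rfl, g, r, η, Equiv.refl _, hgr, hη, fun _ => rfl,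
        fun c => ⟨1, by rw [one_smul]; rfl⟩⟩
    exact ⟨Q, η, T, hη, hT, rfl, rfl, rfl, Fintype.card_fin r, fun _ => ⟨rfl, rfl⟩, Equiv.refl _,
      fun _ => rfl⟩
  · -- RestrictBDOfPSCTypeHolds: `restrict_smoothCurveGenuine` (same `Σ`)
    intro Q _ _ _ H hH
    obtain ⟨_, hc, ht, hd, hN, hV, ⟨v₀, hv⟩, hS, g, r, ι, e, hgr, hι, hgen, hC⟩ := hH
    refine ⟨H.chosenBranchData, fun U _ hU => ?_⟩
    rw [restrictBD_chosen]
    haveI : CompactSpace U := isCompact_iff_compactSpace.mp (U.isClosed_of_isOpen hU).isCompact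
    obtain ⟨hN', hV', hv', g', r', ι', e', h', hι', -, hgen', hC'⟩ :=
      H.restrict_smoothCurveGenuine U hU hV v₀ hv hgr ι hι e hC hgen
    exact ⟨inferInstance, inferInstance, inferInstance, inferInstance, hN', hV', hv', hS, g', r', ι', e', h',
      hι', hgen', hC'⟩
  · obtain ⟨_, hc, ht, hd, -⟩ := hG
    exact ⟨hc, ht, hd⟩
  · -- F-2830: abc-iut-f-166's separating coverings under the relaxed cusp clause
    intro Q _ _ _ G hG
    obtain ⟨_, hc, ht, hd, hN, hV, ⟨v₀, hv⟩, -, g, r, ι, e, hgr, hι, -, hC⟩ := hG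
    exact G.separatingCoverings_of_smoothCurve' G.sigma_nonempty G.sigma_prime hgr ι hι e
      (fun c => (hC c).elim fun δ h => ⟨ConjAct.ofConjAct δ, by rwa [ConjAct.toConjAct_ofConjAct]⟩)
      hV v₀ hv

end PSCDatum

end Literature.AnabelianGeometry.SemiGraphs

end
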